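import Literature.Probability.Moments.BiasedCubeSharpThreshold
import Literature.Probability.Entropy.ConditionedProductMarginals
import Literature.Probability.Entropy.PinskerInequality
import HarnessLib

/-!
# The Level-1 inequality on the biased cube (Talagrand / Chang), sharp constant, entropic proof

Topic `Literature/Probability/Moments`. On the biased cube `({0,1}^n, μ_p^{⊗n})`
(`BiasedCubeLogSobolev.lean`: weights `w p`, expectation `Ep p`), write `φ_i(x) = 𝟙[x_i] − p` for
the centred `i`-th coordinate and, for `g : {0,1}^n → {0,1}` with mean `t = E_p[g]`,
`a_i = E_p[g·φ_i]` (so that `ĝ(i) = a_i/√(p(1−p))` in the orthonormal basis `φ_i/√(p(1−p))`, and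
`a_i = p(1−p)·E_p[g(x^{i,1}) − g(x^{i,0})] = p(1−p)·I_i` with `I_i` the pivotality probability when
`g` is increasing, `Ep_mul_ctr_eq`). We prove

* `levelOne_set` / `levelOne_boolean` — **the Level-1 inequality**
  `Σ_i a_i² ≤ ½ · t² · log(1/t)`, i.e. `W¹[g] = Σ_i ĝ(i)² ≤ t² log(1/t) / (2p(1−p))`;
  at `p = ½` this is the sharp form `W¹[g] ≤ 2t² ln(1/t)` (O'Donnell 2014, §5.3 "Level-1
  Inequality" and Remark 5.28; Talagrand 1996; "Chang's lemma" in additive combinatorics);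
* `levelOne_boolean_compl` — the same with `t` replaced by `1 − t` (apply it to `1 − g`);
* `sum_sq_piv_le` — pivotality form `Σ_i I_i² ≤ t² log(1/t) / (2p²(1−p)²)`, and
  `sum_piv_le_sqrt` — `Σ_i I_i ≤ t·√(n·log(1/t)/2) / (p(1−p))` (Cauchy–Schwarz), the input of the
  "Russo–Talagrand" bound `dP_p(A)/dp ≤ P_p(A)√(|F| log(1/P_p(A))/2)/(p(1−p))` for increasing events
  (`Literature/Probability/Percolation/PercolationLevelOne.lean`), to be compared with the
  Moore–Shannon / Chayes–Chayes–Fisher–Spencer bound `√(|F|·P(1−P)/(p(1−p)))`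
  (`MooreShannonInfluenceBound.lean`).

PROOF (Impagliazzo–Moore–Russell 2014, Lemma 1 — there for the uniform cube with Shannon entropy;
transposed here to `μ_p` with relative entropy, which is routine and ours): let `ν = μ_p(· | A)`,
`A = {g = 1}`, `t = μ_p(A)`. Then `D(ν ‖ μ_p) = log(1/t)` (`margDiv_univ`), relative entropy w.r.t. a
product measure is superadditive over the coordinates, `Σ_i D(ν_i ‖ μ_p^{(i)}) ≤ D(ν ‖ μ_p)`
(`sum_le_mul_of_supermodular_chain` with the chain rule / "conditioning reduces entropy" of
`ConditionedProductMarginals.lean`), the `i`-th marginal of `ν` is Bernoulli with parameter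
`q_i = p + a_i/t` (`margDiv_singleton_eq`), and Pinsker's inequality for two Bernoulli laws,
`kl(q ‖ p) ≥ 2(q − p)²` (tree: `two_mul_sq_sub_le_binaryKL` on `(0,1)`, closed up at `q ∈ {0,1}`
here), gives `2 Σ_i (a_i/t)² ≤ log(1/t)`.

Everything is a finite sum and is proved; no named facts, no definitions. Mathlib has no level-1 /
Chang inequality; the tree had the uniform-cube level-`k` inequalities by Bonami's lemma
(`Literature/Computability/Complexity/BonamiLevelK.lean`, `levelK_le_log`) and, on the biased cube,
the log-Sobolev / Talagrand–Rossignol sharp-threshold inequality (`BiasedCubeSharpThreshold.lean`),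
but not the biased level-1 bound.

## References

* R. O'Donnell, *Analysis of Boolean Functions*, CUP 2014, §5.3 "Level-1 Inequality", Remark 5.28
  (sharp form `2α² ln(1/α)`), notes §5.6 ("probably first published in Talagrand [Tal96]")
  [ODonnell2014].
* M. Talagrand, *How much are increasing sets positively correlated?*, Combinatorica 16 (1996)
  243–258 [Talagrand1996].
* R. Impagliazzo, C. Moore, A. Russell, *An entropic proof of Chang's inequality*, SIAM J. Discrete
  Math. 28 (2014) 173–176, Lemma 1 [ImpagliazzoMooreRussell2014].
* Y. Polyanskiy, Y. Wu, *Information Theory*, CUP 2024, Thm 7.10 (Pinsker) [PolyanskiyWu2024].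
-/

noncomputable section

namespace Literature.Probability.Moments

namespace BiasedCube

open Finset Real Literature.Probability.Entropy Literature.Probability.Entropy.FiniteShannon

variable {n : ℕ}

/-! ## Binary Pinsker on the closed interval -/

/-- `2(1 − p)² ≤ −log p` for `0 < p ≤ 1` (Pinsker for `Ber(1)` vs `Ber(p)`): the function
`t ↦ −log t − 2(1−t)²` has derivative `−(1−2t)²/t ≤ 0` and vanishes at `t = 1`.
[cite: PolyanskiyWu2024, Thm 7.10 (binary case, endpoint)] -/
theorem two_mul_sq_one_sub_le_neg_log {p : ℝ} (hp0 : 0 < p) (hp1 : p ≤ 1) :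
    2 * (1 - p) ^ 2 ≤ -Real.log p := by
  set h : ℝ → ℝ := fun t => -Real.log t - 2 * (1 - t) ^ 2 with hh
  have hderiv : ∀ t : ℝ, 0 < t → HasDerivAt h (-t⁻¹ + 4 * (1 - t)) t := by
    intro t ht
    have h1 : HasDerivAt (fun t : ℝ => -Real.log t) (-t⁻¹) t := (Real.hasDerivAt_log ht.ne').neg
    have h2 : HasDerivAt (fun t : ℝ => 2 * (1 - t) ^ 2) (2 * (2 * (1 - t) * (-1))) t := by
      have hsq : HasDerivAt (fun t : ℝ => (1 - t) ^ 2) (2 * (1 - t) * (-1)) t := by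
        have h1 := ((hasDerivAt_id t).const_sub 1).mul ((hasDerivAt_id t).const_sub 1)
        refine (h1.congr_of_eventuallyEq (Filter.Eventually.of_forall fun s => ?_)).congr_deriv ?_
        · simp [pow_two]
        · simp only [id_eq]; ring
      exact hsq.const_mul 2
    have := h1.sub h2
    refine this.congr_deriv ?_
    ring
  have hcont : ContinuousOn h (Set.Icc p 1) :=
    fun t ht => (hderiv t (hp0.trans_le ht.1)).continuousAt.continuousWithinAt
  have hanti : AntitoneOn h (Set.Icc p 1) := by
    refine antitoneOn_of_deriv_nonpos (convex_Icc p 1) hcont ?_ ?_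
    · rw [interior_Icc]
      exact fun t ht => (hderiv t (hp0.trans ht.1)).differentiableAt.differentiableWithinAt
    · rw [interior_Icc]
      intro t ht
      have ht0 : 0 < t := hp0.trans ht.1
      rw [(hderiv t ht0).deriv]
      have : -t⁻¹ + 4 * (1 - t) = -((1 - 2 * t) ^ 2 / t) := by
        field_simp
        ring
      rw [this, neg_nonpos]
      exact div_nonneg (sq_nonneg _) ht0.le
  have h1 : h 1 = 0 := by simp [hh]
  have := hanti (Set.left_mem_Icc.2 hp1) (Set.right_mem_Icc.2 hp1) hp1
  rw [h1] at this
  have : 0 ≤ -Real.log p - 2 * (1 - p) ^ 2 := this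
  linarith

/-- **Binary Pinsker inequality on the closed interval**: `2(q − p)² ≤ kl(q ‖ p)` for
`q ∈ [0,1]`, `p ∈ (0,1)` (interior: the tree's `two_mul_sq_sub_le_binaryKL`; endpoints
`kl(1 ‖ p) = −log p`, `kl(0 ‖ p) = −log(1−p)`). Private: the same closed-interval statement is
proved independently in `Summits/AtomisticToContinuum/…PredictableProjectionPinsker.lean`, which a
Literature file cannot import. [cite: PolyanskiyWu2024, Thm 7.10 (binary case)] -/
private theorem two_mul_sq_sub_le_binaryKL_of_mem_Icc {q p : ℝ} (hq0 : 0 ≤ q) (hq1 : q ≤ 1)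
    (hp0 : 0 < p) (hp1 : p < 1) : 2 * (q - p) ^ 2 ≤ binaryKL q p := by
  rcases hq0.eq_or_lt with hq | hq0'
  · -- `q = 0`
    rw [← hq, binaryKL_eq 0 hp0 hp1]
    have h0 : (0:ℝ) * Real.log 0 + (1 - 0) * Real.log (1 - 0) - 0 * Real.log p - (1 - 0) * Real.log (1 - p) =
        -Real.log (1 - p) := by simp
    have e : ((0:ℝ) - p) ^ 2 = (1 - (1 - p)) ^ 2 := by ring
    rw [h0, e]
    exact two_mul_sq_one_sub_le_neg_log (p := 1 - p) (by linarith) (by linarith)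
  rcases hq1.lt_or_eq with hq1' | hq
  · exact two_mul_sq_sub_le_binaryKL hq0' hq1' hp0 hp1
  · -- `q = 1`
    rw [hq, binaryKL_eq 1 hp0 hp1]
    have h1 : (1:ℝ) * Real.log 1 + (1 - 1) * Real.log (1 - 1) - 1 * Real.log p - (1 - 1) * Real.log (1 - p) =
        -Real.log p := by simp
    rw [h1]
    exact two_mul_sq_one_sub_le_neg_log hp0 hp1.le

/-! ## The biased cube as a product weight; the one-coordinate marginals of a conditioned law -/

/-- The product weight of the constant coordinate family `(wt p)_{i < n}` is the cube weight `w p`.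
[folklore] -/
private theorem prodWeight_wt (p : ℝ) : prodWeight (fun (_ : Fin n) (b : Bool) => wt p b) = w p := by
  funext x; rfl

/-- The one-bit laws are positive for `0 < p < 1`. [folklore] -/
private theorem wt_pos {p : ℝ} (hp0 : 0 < p) (hp1 : p < 1) (b : Bool) : 0 < wt p b := by
  cases b <;> simp [wt] <;> linarith

/-- `P(x_i = 0 | A) = 1 − P(x_i = 1 | A)` for a nonempty `A`. [folklore] -/
private theorem prob_false_eq {p : ℝ} (hp0 : 0 < p) (hp1 : p < 1) {s : Finset (Fin n → Bool)}
    (hs : s.Nonempty) (i : Fin n) :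
    prob s (w p) (fun x => x i) false = 1 - prob s (w p) (fun x => x i) true := by
  have hM : 0 < mass s (w p) := mass_pos (fun x _ => w_pos hp0 hp1 x) hs
  have h := sum_prob_eq_one (X := fun x : Fin n → Bool => x i) hM (subset_univ _)
  rw [Fintype.sum_bool] at h
  linarith

/-- **The singleton marginal divergence is the binary relative entropy**: for the product weight
`μ_p^{⊗n}` conditioned on a nonempty `A ⊆ {0,1}^n`, with `q_i = P(x_i = 1 | A)`,
`D({i}) = D_KL(Ber(q_i) ‖ Ber(p)) = kl(q_i ‖ p)` (the marginal entropies `h(p_i^+)` of the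
printed proof, in relative form). [cite: ImpagliazzoMooreRussell2014, Lemma 1 (proof, the marginals p_i^+)] -/
theorem margDiv_singleton_eq {p : ℝ} (hp0 : 0 < p) (hp1 : p < 1) {s : Finset (Fin n → Bool)}
    (hs : s.Nonempty) (i : Fin n) :
    margDiv (fun (_ : Fin n) (b : Bool) => wt p b) s {i} =
      binaryKL (prob s (w p) (fun x => x i) true) p := by
  set q := prob s (w p) (fun x => x i) true with hq
  have hqF : prob s (w p) (fun x => x i) false = 1 - q := prob_false_eq hp0 hp1 hs i
  unfold margDiv
  rw [sum_singleton, prodWeight_wt]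
  -- the cross-entropy of coordinate `i`
  have hcross : coordCrossEnt (fun (_ : Fin n) (b : Bool) => wt p b) s i =
      q * (-Real.log p) + (1 - q) * (-Real.log (1 - p)) := by
    unfold coordCrossEnt
    rw [prodWeight_wt, Fintype.sum_bool, ← hq, hqF]
    beta_reduce
    rw [wt_true, wt_false]
  -- the entropy of the pattern `V_{{i}}` is the entropy of the bit `x_i`
  have hent : ent s (w p) (restrictTo ({i} : Finset (Fin n))) = negMulLog q + negMulLog (1 - q) := by
    set e : Bool → (Fin n → Bool) := fun b y => if y = i then b else default with he
    have hcomp : (restrictTo ({i} : Finset (Fin n)) : (Fin n → Bool) → (Fin n → Bool)) =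
        e ∘ fun x => x i := by
      funext x y
      simp only [restrictTo_apply, mem_singleton, Function.comp_apply, he]
      by_cases hy : y = i
      · subst hy; simp
      · simp [hy]
    have hinj : Set.InjOn e ((s.image fun x => x i : Finset Bool) : Set Bool) := by
      intro b _ b' _ hbb'
      have := congr_fun hbb' i
      simpa [he] using this
    rw [hcomp, ent_comp_of_injOn hinj, ent_eq_sum_of_subset (subset_univ _), Fintype.sum_bool,
      ← hq, hqF]
  rw [hcross, hent, binaryKL_eq q hp0 hp1]
  simp only [Real.negMulLog]
  ring

/-- **Superadditivity of relative entropy over the coordinates of a product measure**, summed: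
`Σ_i kl(q_i ‖ p) ≤ D(ν ‖ μ_p^{⊗n}) = log(1/μ_p(A))` for `ν = μ_p(· | A)`.
[cite: ImpagliazzoMooreRussell2014, Lemma 1 (proof: H(x) ≤ Σ H(x_i))] -/
theorem sum_binaryKL_le_neg_log_mass {p : ℝ} (hp0 : 0 < p) (hp1 : p < 1)
    {s : Finset (Fin n → Bool)} (hs : s.Nonempty) :
    ∑ i : Fin n, binaryKL (prob s (w p) (fun x => x i) true) p ≤ -Real.log (mass s (w p)) := by
  have hμ : ∀ (y : Fin n) (b : Bool), 0 < (fun (_ : Fin n) (b : Bool) => wt p b) y b :=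
    fun _ b => wt_pos hp0 hp1 b
  have hμ1 : ∀ y : Fin n, ∑ b, (fun (_ : Fin n) (b : Bool) => wt p b) y b = 1 := fun _ => sum_wt p
  have hchain := sum_le_mul_of_supermodular_chain (margDiv (fun (_ : Fin n) (b : Bool) => wt p b) s)
    (margDiv_empty _ hμ s)
    (fun J y hy => margDiv_le_insert _ hμ hμ1 s hs hy)
    (fun J J' y hJ hy => margDiv_insert_sub_le _ hμ s hJ hy)
    (univ : Finset (Fin n)) 1 univ (fun i => ({i} : Finset (Fin n))) (fun i _ => subset_univ _)
    (fun y _ => by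
      have : (univ.filter fun x : Fin n => y ∈ ({x} : Finset (Fin n))) = {y} := by
        ext x; simp [mem_singleton, eq_comm]
      rw [this, card_singleton]; simp)
  rw [one_mul, margDiv_univ _ hμ hμ1 s hs, prodWeight_wt] at hchain
  calc ∑ i : Fin n, binaryKL (prob s (w p) (fun x => x i) true) p
      = ∑ i : Fin n, margDiv (fun (_ : Fin n) (b : Bool) => wt p b) s {i} :=
        sum_congr rfl fun i _ => (margDiv_singleton_eq hp0 hp1 hs i).symm
    _ ≤ -Real.log (mass s (w p)) := hchain

/-! ## The Level-1 inequality -/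

/-- **Level-1 inequality, set form.** For `0 < p < 1` and any `A ⊆ {0,1}^n` with `t = μ_p(A)`:
`Σ_i (μ_p(A ∩ {x_i = 1}) − p·μ_p(A))² ≤ ½ · t² · log(1/t)` (i.e. `Σ_i a_i² ≤ ½ t² log(1/t)` with
`a_i = E_p[𝟙_A φ_i]`; in Fourier normalisation `W¹[𝟙_A] ≤ t² log(1/t)/(2p(1−p))`, the sharp
`2t² ln(1/t)` at `p = ½`).
[cite: ODonnell2014, §5.3 "Level-1 Inequality" and Remark 5.28] [cite: ImpagliazzoMooreRussell2014, Lemma 1] -/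
theorem levelOne_set {p : ℝ} (hp0 : 0 < p) (hp1 : p < 1) (s : Finset (Fin n → Bool)) :
    ∑ i : Fin n, (mass (s.filter fun x => x i = true) (w p) - p * mass s (w p)) ^ 2 ≤
      mass s (w p) ^ 2 * (-Real.log (mass s (w p))) / 2 := by
  rcases s.eq_empty_or_nonempty with rfl | hs
  · simp [mass]
  have hM : 0 < mass s (w p) := mass_pos (fun x _ => w_pos hp0 hp1 x) hs
  have hq : ∀ i : Fin n, mass (s.filter fun x => x i = true) (w p) - p * mass s (w p) =
      mass s (w p) * (prob s (w p) (fun x => x i) true - p) := by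
    intro i
    rw [prob_def, mul_sub, mul_div_assoc', mul_div_cancel_left₀ _ hM.ne']
    ring
  have hpin : ∀ i : Fin n, 2 * (prob s (w p) (fun x => x i) true - p) ^ 2 ≤
      binaryKL (prob s (w p) (fun x => x i) true) p := fun i =>
    two_mul_sq_sub_le_binaryKL_of_mem_Icc (prob_nonneg (fun x _ => (w_pos hp0 hp1 x).le) _)
      (prob_le_one (fun x _ => (w_pos hp0 hp1 x).le) _) hp0 hp1
  have hsum := sum_binaryKL_le_neg_log_mass hp0 hp1 hs
  calc ∑ i : Fin n, (mass (s.filter fun x => x i = true) (w p) - p * mass s (w p)) ^ 2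
      = mass s (w p) ^ 2 * ∑ i : Fin n, (prob s (w p) (fun x => x i) true - p) ^ 2 := by
        rw [mul_sum]
        exact sum_congr rfl fun i _ => by rw [hq i]; ring
    _ ≤ mass s (w p) ^ 2 * ((∑ i : Fin n, binaryKL (prob s (w p) (fun x => x i) true) p) / 2) := by
        refine mul_le_mul_of_nonneg_left ?_ (sq_nonneg _)
        rw [le_div_iff₀ (by norm_num : (0:ℝ) < 2), sum_mul]
        exact sum_le_sum fun i _ => by linarith [hpin i]
    _ ≤ mass s (w p) ^ 2 * (-Real.log (mass s (w p)) / 2) := by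
        refine mul_le_mul_of_nonneg_left ?_ (sq_nonneg _)
        linarith
    _ = _ := by ring

/-! ## Function forms: `{0,1}`-valued `g`, centred coordinates, pivotality -/

/-- For a `{0,1}`-valued `g`, `E_p[g] = μ_p({g = 1})`. [folklore] -/
private theorem Ep_eq_mass_filter {p : ℝ} {g : (Fin n → Bool) → ℝ} (hbool : ∀ x, g x = 0 ∨ g x = 1) :
    Ep p g = mass (univ.filter fun x => g x = 1) (w p) := by
  rw [mass_def, sum_filter]
  unfold Ep
  refine sum_congr rfl fun x _ => ?_
  rcases hbool x with h | h <;> simp [h]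

/-- For a `{0,1}`-valued `g`, `E_p[g·φ_i] = μ_p({g = 1} ∩ {x_i = 1}) − p·μ_p({g = 1})`. [folklore] -/
private theorem Ep_mul_ctr_eq_mass {p : ℝ} {g : (Fin n → Bool) → ℝ} (hbool : ∀ x, g x = 0 ∨ g x = 1)
    (i : Fin n) :
    Ep p (fun x => g x * ((if x i then (1:ℝ) else 0) - p)) =
      mass ((univ.filter fun x => g x = 1).filter fun x => x i = true) (w p) -
        p * mass (univ.filter fun x => g x = 1) (w p) := by
  unfold Ep
  rw [mass_def, mass_def, sum_filter, sum_filter, sum_filter, mul_sum, ← sum_sub_distrib]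
  refine sum_congr rfl fun x _ => ?_
  rcases hbool x with h | h <;> cases hx : x i <;> simp [h, hx] <;> ring

/-- **`E_p[g·φ_i] = p(1−p)·E_p[g(x^{i,1}) − g(x^{i,0})]`** for every `g` (average over the `i`-th
bit first): the weighted pivotality / the biased Fourier coefficient at `{i}` up to `√(p(1−p))`.
[cite: ODonnell2014, §8.4 (Prop 8.45, biased Fourier coefficient of degree 1)] -/
theorem Ep_mul_ctr_eq (p : ℝ) (i : Fin n) (g : (Fin n → Bool) → ℝ) :
    Ep p (fun x => g x * ((if x i then (1:ℝ) else 0) - p)) = p * (1 - p) * Ep p (piv i g) := by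
  rw [Ep_eq_Ep_T_eMask p i, ← Ep_smul]
  congr 1
  funext x
  have h1 : (if Function.update x i true i then (1:ℝ) else 0) = 1 := by
    rw [Function.update_self, if_pos rfl]
  have h0 : (if Function.update x i false i then (1:ℝ) else 0) = 0 := by
    rw [Function.update_self, if_neg Bool.false_ne_true]
  rw [h1, h0, piv]
  ring

/-- `E_p[φ_i] = 0`: the centred coordinate has mean zero.
[cite: ODonnell2014, §8.4 Def 8.40 (φ(x_i) has mean zero under π)] -/
theorem Ep_ctr (p : ℝ) (i : Fin n) : Ep p (fun x => (if x i then (1:ℝ) else 0) - p) = 0 := by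
  have h := Ep_mul_ctr_eq p i (fun _ => (1:ℝ))
  simp only [one_mul] at h
  rw [h]
  have : piv i (fun _ : Fin n → Bool => (1:ℝ)) = fun _ => 0 := by funext x; simp [piv]
  rw [this, Ep_const]; ring

/-- **Level-1 inequality for `{0,1}`-valued functions** on the biased cube:
`Σ_i E_p[g·φ_i]² ≤ ½ · E_p[g]² · log(1/E_p[g])`.
[cite: ODonnell2014, §5.3 "Level-1 Inequality"] [cite: ImpagliazzoMooreRussell2014, Lemma 1] -/
theorem levelOne_boolean {p : ℝ} (hp0 : 0 < p) (hp1 : p < 1) {g : (Fin n → Bool) → ℝ}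
    (hbool : ∀ x, g x = 0 ∨ g x = 1) :
    ∑ i : Fin n, Ep p (fun x => g x * ((if x i then (1:ℝ) else 0) - p)) ^ 2 ≤
      Ep p g ^ 2 * (-Real.log (Ep p g)) / 2 := by
  rw [Ep_eq_mass_filter hbool]
  simp_rw [Ep_mul_ctr_eq_mass hbool]
  exact levelOne_set hp0 hp1 _

/-- **Level-1 inequality, complementary form** (`g ↦ 1 − g`):
`Σ_i E_p[g·φ_i]² ≤ ½ · (1 − E_p[g])² · log(1/(1 − E_p[g]))`.
[cite: ODonnell2014, §5.3 "Level-1 Inequality" ("for the case α ≥ 1/2, replace f by 1 − f")] -/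
theorem levelOne_boolean_compl {p : ℝ} (hp0 : 0 < p) (hp1 : p < 1) {g : (Fin n → Bool) → ℝ}
    (hbool : ∀ x, g x = 0 ∨ g x = 1) :
    ∑ i : Fin n, Ep p (fun x => g x * ((if x i then (1:ℝ) else 0) - p)) ^ 2 ≤
      (1 - Ep p g) ^ 2 * (-Real.log (1 - Ep p g)) / 2 := by
  have hbool' : ∀ x, (1 - g x) = 0 ∨ (1 - g x) = 1 := fun x => by
    rcases hbool x with h | h <;> simp [h]
  have h := levelOne_boolean hp0 hp1 hbool'
  have hE : Ep p (fun x => 1 - g x) = 1 - Ep p g := by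
    rw [show (fun x => 1 - g x) = fun x => (1:ℝ) - g x from rfl, Ep_sub, Ep_const]
  have hEi : ∀ i : Fin n, Ep p (fun x => (1 - g x) * ((if x i then (1:ℝ) else 0) - p)) =
      -Ep p (fun x => g x * ((if x i then (1:ℝ) else 0) - p)) := by
    intro i
    have : (fun x => (1 - g x) * ((if x i then (1:ℝ) else 0) - p)) =
        fun x => ((if x i then (1:ℝ) else 0) - p) - g x * ((if x i then (1:ℝ) else 0) - p) := by
      funext x; ring
    rw [this, Ep_sub, Ep_ctr]; ring
  rw [hE] at h
  simp_rw [hEi, neg_sq] at h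
  exact h

/-- **Level-1 inequality, pivotality form**: for a `{0,1}`-valued `g` with `t = E_p[g]` and
`I_i = E_p[g(x^{i,1}) − g(x^{i,0})]` (the pivotality probability of bit `i` when `g` is increasing),
`Σ_i I_i² ≤ t² log(1/t) / (2p²(1−p)²)`. Compare the Bessel / Moore–Shannon bound
`Σ_i I_i² ≤ t(1−t)/(p(1−p))` (`prodBernoulli_levelOne_le`). [cite: ODonnell2014, §5.3 "Level-1 Inequality"] -/
theorem sum_sq_piv_le {p : ℝ} (hp0 : 0 < p) (hp1 : p < 1) {g : (Fin n → Bool) → ℝ}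
    (hbool : ∀ x, g x = 0 ∨ g x = 1) :
    ∑ i : Fin n, Ep p (piv i g) ^ 2 ≤ Ep p g ^ 2 * (-Real.log (Ep p g)) / (2 * (p * (1 - p)) ^ 2) := by
  have hpq : 0 < p * (1 - p) := mul_pos hp0 (by linarith)
  have h := levelOne_boolean hp0 hp1 hbool
  simp_rw [Ep_mul_ctr_eq, mul_pow] at h
  rw [← mul_sum] at h
  rw [le_div_iff₀ (by positivity)]
  have e : (∑ i : Fin n, Ep p (piv i g) ^ 2) * (2 * (p * (1 - p)) ^ 2) =
      2 * (p ^ 2 * (1 - p) ^ 2 * ∑ i : Fin n, Ep p (piv i g) ^ 2) := by ring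
  rw [e]
  linarith

/-- **Sum of pivotality probabilities via the Level-1 inequality** (Cauchy–Schwarz): for a
`{0,1}`-valued `g` on `{0,1}^n` with `t = E_p[g]`, `Σ_i I_i ≤ t·√(n·log(1/t)/2)/(p(1−p))`. With
Russo's formula this is the "Russo–Talagrand" bound on `dP_p(A)/dp`; it beats the Moore–Shannon
bound `√(n·t(1−t)/(p(1−p)))` when `t log(1/t) ≲ 2p(1−p)(1−t)`, i.e. for rare events.
[cite: ODonnell2014, §5.3 "Level-1 Inequality"] -/
theorem sum_piv_le_sqrt {p : ℝ} (hp0 : 0 < p) (hp1 : p < 1) {g : (Fin n → Bool) → ℝ}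
    (hbool : ∀ x, g x = 0 ∨ g x = 1) :
    ∑ i : Fin n, Ep p (piv i g) ≤
      Ep p g * Real.sqrt (n * (-Real.log (Ep p g)) / 2) / (p * (1 - p)) := by
  have hpq : 0 < p * (1 - p) := mul_pos hp0 (by linarith)
  have ht0 : 0 ≤ Ep p g := Ep_nonneg hp0.le hp1.le fun x => by rcases hbool x with h | h <;> simp [h]
  have ht1 : Ep p g ≤ 1 := by
    calc Ep p g ≤ Ep p (fun _ => (1:ℝ)) := Ep_mono hp0.le hp1.le fun x => by
            rcases hbool x with h | h <;> simp [h]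
      _ = 1 := Ep_const p 1
  have hL : 0 ≤ -Real.log (Ep p g) := by
    rw [neg_nonneg]; exact Real.log_nonpos ht0 ht1
  -- Cauchy–Schwarz: `(Σ I_i)² ≤ n Σ I_i²`
  have hCS : (∑ i : Fin n, Ep p (piv i g)) ^ 2 ≤ n * ∑ i : Fin n, Ep p (piv i g) ^ 2 := by
    have h := sum_mul_sq_le_sq_mul_sq (univ : Finset (Fin n)) (fun _ => (1:ℝ)) (fun i => Ep p (piv i g))
    simp only [one_mul, one_pow, sum_const, card_univ, Fintype.card_fin, nsmul_eq_mul, mul_one] at h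
    exact h
  have hsq : (∑ i : Fin n, Ep p (piv i g)) ^ 2 ≤
      (Ep p g * Real.sqrt (n * (-Real.log (Ep p g)) / 2) / (p * (1 - p))) ^ 2 := by
    rw [div_pow, mul_pow, Real.sq_sqrt (div_nonneg (mul_nonneg (Nat.cast_nonneg n) hL) zero_le_two)]
    have h2 := sum_sq_piv_le hp0 hp1 hbool
    calc (∑ i : Fin n, Ep p (piv i g)) ^ 2 ≤ n * ∑ i : Fin n, Ep p (piv i g) ^ 2 := hCS
      _ ≤ n * (Ep p g ^ 2 * (-Real.log (Ep p g)) / (2 * (p * (1 - p)) ^ 2)) :=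
          mul_le_mul_of_nonneg_left h2 (Nat.cast_nonneg n)
      _ = Ep p g ^ 2 * (n * (-Real.log (Ep p g)) / 2) / (p * (1 - p)) ^ 2 := by
          field_simp
  have hR : 0 ≤ Ep p g * Real.sqrt (n * (-Real.log (Ep p g)) / 2) / (p * (1 - p)) :=
    div_nonneg (mul_nonneg ht0 (Real.sqrt_nonneg _)) hpq.le
  exact (abs_le_of_sq_le_sq' hsq hR).2

end BiasedCube

end Literature.Probability.Moments

end
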